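import Literature.IUT.LogThetaLattice.ThetaPilotObjectsRoot
import HarnessLib

/-!
# [IUTchIII] Proposition 3.7 / Definition 3.8 (i) at the Dupuy–Hilado level: the output signature of
# Prop. 3.7 READ ON ARITHMETIC DIVISORS, and the Θ-pilot object as the theta-pilot lgp-divisor
# (abc-iut cell, layer L6 ↔ Cor. 3.12 crew; sequel of `ThetaPilotObjectsReal.lean` / `ThetaPilotObjectsRoot.lean`)

S. Mochizuki, *Inter-universal Teichmüller theory III*, kurims manuscript (May 2020), §3, Proposition 3.7
pp. 109–112 (the global realified LGP- and lgp-Frobenioids `†𝒞^⊩_LGP`, `†𝒞^⊩_lgp`, the Frobenioids `(†𝓕⊛_MOD)_j`,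
`(†𝓕⊛_mod)_j`, `(†𝓕⊛_𝔪𝔬𝔡)_j`, the realified product embeddings `†𝒞^⊩_LGP ↪ Π_j (†𝓕⊛ℝ_MOD)_j`,
`†𝒞^⊩_lgp ↪ Π_j (†𝓕⊛ℝ_𝔪𝔬𝔡)_j` of (v) and "an algorithm for constructing … objects of the [global!] categories …
from the local fractional ideals generated by elements of the monoids `Ψ_{𝓕_lgp}(†𝓗𝓣)_v` for `v ∈ 𝕍^bad`") and
Definition 3.8 (i) p. 112 (the Θ-pilot object) [claim: Mochizuki2012, status: disputed]; T. Dupuy, A. Hilado,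
*The statement of Mochizuki's Corollary 3.12*, §3.3–3.4: the objects of the global realified Frobenioids are
read as `ℝ`-arithmetic divisors, the Θ-pilot object as the lgp-divisor `P_Θ = (Σ_v ord_v(q̲_v^{j²})[v])_j`
[cite: DupuyHilado2025, §3.3].

abc-iut-L6-t4's statement file types Prop. 3.7 as the OUTPUT SIGNATURE `GlobalLGPFrobenioidSignature` over
abstract Frobenioids/strips (`ThetaPilotObjects.lean`, p404500) — the binder `sig` of the Cor. 3.12 crew's
`Summit.ABC.IUTFork.Cor312.Setting.ofComparison` (abc-iut-c312-7; `HOME/plan/C312-RESIDUALS.md` §1a′; the only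
inhabitant in the tree so far is c312-7's satisfiability witness `toySig` over `Unit`). This file supplies the
signature AT THE DUPUY–HILADO LEVEL of the Cor. 3.12 crew's chain (abc-iut-c312-3 `PilotDivisors`, `LDH*`), i.e.
with every Frobenioid REPLACED BY ITS GROUP OF `ℝ`-ARITHMETIC DIVISORS (a DECATEGORIFIED model: morphisms,
Frobenius degrees, base categories and the unit portions are forgotten; realification is invisible on
`ℝ`-divisors; the isomorphisms of Frobenioids of (i)(ii)(v) become the identity of the divisor groups; the
`𝓕^⊩`-prime-strips are bare names whose isomorphism types are singletons, so the full poly-isomorphisms of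
Def. 3.8 (ii) carry no data, cf. `LGPGaussianLogThetaLattice`):

* `LGPFrobenioidName l⋆` / `LGPStripName` — the NAMES `(†𝓕⊛_MOD)_j, (†𝓕⊛_mod)_j, (†𝓕⊛_𝔪𝔬𝔡)_j, †𝒞^⊩_LGP, †𝒞^⊩_lgp`
  and `†𝔉^⊩_LGP, †𝔉^⊩_lgp, †𝔉^⊩_gau`; `divisorObjects X` — their objects read as divisors: `FinDivisor F` for the
  `(†𝓕⊛_*)_j`, `LgpDivisor F l⋆ = (Fin l⋆ → FinDivisor F)` for `†𝒞^⊩_LGP/lgp` (c312-3), so that the realified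
  product embeddings of (v) are the IDENTITY (injective: `Function.injective_id`);
* **`divisorSignature X obj`** — the `GlobalLGPFrobenioidSignature` so obtained, for ANY object-forming map
  `obj : (∀ v ∈ S, Fin l⋆ → F_vˣ) → LgpDivisor F l⋆` (Prop. 3.7 (v)); the two honest choices of `obj` are
  `thetaObjOf X` (`q_v`-convention, coefficient `1/2l`: **`divisorSignatureDH X`**) and `thetaObjOfRoot X`
  (printed root convention: **`divisorSignatureRoot X`**);
* **`thetaPilotObject_divisorSignatureDH`**: `thetaPilotObject (divisorSignatureDH X) (SplittingMonoids.dh X τ ζ)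
  = X.thetaPilot` and **`thetaPilotObject_divisorSignatureRoot`**: `thetaPilotObject (divisorSignatureRoot X)
  (SplittingMonoids.dhRoot X ρ ζ) = X.thetaPilot` — the Θ-pilot object of Definition 3.8 (i) IS c312-3's
  theta-pilot lgp-divisor `P_Θ` at this level, with NO factorisation hypothesis left (the `hΦ` of
  `thetaPilotObject_eq_of_factors` is `rfl`, `Φ = id`), and `thetaPilotObject_wellDefined` HOLDS
  (`thetaPilotObject_wellDefined_divisorSignatureDH/Root`).

With `split := SplittingMonoids.dh/dhRoot`, `qData := QPilotData.dh/dhRoot` (`ThetaPilotObjectsReal/Root`) and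
`sig := divisorSignatureDH/Root`, the three abc-iut-L6-t4-owned binders of `Cor312.Setting.ofComparison` have
Dupuy–Hilado-level inhabitants whose pilot objects are c312-3's `thetaPilot` / `qPilot` by theorems. Honest
framing: this is the DECATEGORIFIED Dupuy–Hilado reading, NOT a construction of the Frobenioids of Prop. 3.7
(Example 3.6 (i)(ii) categories: abc-iut-L6-t4 `GlobalFrobenioidModels` + abc-iut-L6-t6 `FrakCat`; [FrdI]:
layer L1; `𝓕^⊩`-prime-strips: abc-iut-L5-t4 `FPrimeStrips`) — that construction is the layer's open
"Prop. 3.7 NEEDS" item. Nothing here asserts a disputed claim or takes a side on [IUTchIII] Cor. 3.12; typed ≠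
discharged; instantiated ≠ endorsed.
-/

noncomputable section

namespace Literature.IUT.LogThetaLattice

open Literature.IUT.HodgeArakelov Literature.IUT.LogVolume NumberField IsDedekindDomain
open Literature.NumberTheory.EllipticCurves

/-! ### Names of the Frobenioids and strips of Prop. 3.7 -/

/-- The NAMES of the Frobenioids output by [IUTchIII] Prop. 3.7 (i)–(iv) pp. 109–111: `(†𝓕⊛_MOD)_j`,
`(†𝓕⊛_mod)_j`, `(†𝓕⊛_𝔪𝔬𝔡)_j` (`j ∈ 𝔽_l^⋇ = Fin l⋆`), `†𝒞^⊩_LGP`, `†𝒞^⊩_lgp`. [claim: Mochizuki2012, status: disputed] -/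
inductive LGPFrobenioidName (lstar : ℕ) : Type
  /-- `(†𝓕⊛_MOD)_j` (Prop. 3.7 (i); Example 3.6 (i)) -/
  | MOD (j : Fin lstar)
  /-- `(†𝓕⊛_mod)_j` ([IUTchII] Cor. 4.8 (ii)) -/
  | smallMod (j : Fin lstar)
  /-- `(†𝓕⊛_𝔪𝔬𝔡)_j` (Prop. 3.7 (ii); Example 3.6 (ii)) -/
  | frak (j : Fin lstar)
  /-- `†𝒞^⊩_LGP` (Prop. 3.7 (iii)) -/
  | CLGP
  /-- `†𝒞^⊩_lgp` (Prop. 3.7 (iv)) -/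
  | Clgp

/-- The NAMES of the `𝓕^⊩`-prime-strips of [IUTchIII] Prop. 3.7 (iii)(iv) pp. 110–111 and [IUTchII] Cor. 4.10
(ii): `†𝔉^⊩_LGP`, `†𝔉^⊩_lgp`, `†𝔉^⊩_gau`. [claim: Mochizuki2012, status: disputed] -/
inductive LGPStripName : Type
  /-- `†𝔉^⊩_LGP` -/
  | LGP
  /-- `†𝔉^⊩_lgp` -/
  | lgp
  /-- `†𝔉^⊩_gau` -/
  | gau

section DivisorSignature

variable {F : Type} [Field F] [NumberField F] (X : PilotData F)

/-- The objects of the Prop. 3.7 Frobenioids READ AS `ℝ`-ARITHMETIC DIVISORS (Dupuy–Hilado §3.3–3.4): objects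
of `(†𝓕⊛_*)_j` ↦ `FinDivisor F` (arithmetic divisors / line bundles on the number field, [IUTchIII] Ex. 3.6
(i)(ii)), objects of the global realified `†𝒞^⊩_LGP`, `†𝒞^⊩_lgp` ↦ abc-iut-c312-3's `LgpDivisor F l⋆ = Π_{j ∈ 𝔽_l^⋇}
FinDivisor F` (so that the realified product embeddings of Prop. 3.7 (v) are the identity).
[cite: DupuyHilado2025, §3.3] -/
def divisorObjects : LGPFrobenioidName X.lstar → Type
  | .MOD _ => FinDivisor F
  | .smallMod _ => FinDivisor F
  | .frak _ => FinDivisor F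
  | .CLGP => LgpDivisor F X.lstar
  | .Clgp => LgpDivisor F X.lstar

/-- **The output signature of [IUTchIII] Prop. 3.7 at the Dupuy–Hilado (divisor) level** for pilot data `X`
and an object-forming map `obj` (Prop. 3.7 (v) "objects … from the local fractional ideals generated by
elements of the monoids `Ψ_{𝓕_lgp}(†𝓗𝓣)_v` for `v ∈ 𝕍^bad`", read as an lgp-divisor): Frobenioids = names
with divisor groups as objects, their isomorphisms (i)(ii)(v) = the identity equivalence of the divisor
groups, realification = identity (divisors already `ℝ`-valued), strips = names with singleton isomorphism
types, embeddings (v) = identity. DECATEGORIFIED MODEL (see the module docstring).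
[claim: Mochizuki2012, status: disputed] -/
def divisorSignature
    (obj : (∀ v (_ : v ∈ X.S), Fin X.lstar → (v.adicCompletion F)ˣ) → LgpDivisor F X.lstar) :
    GlobalLGPFrobenioidSignature X.lstar (HeightOneSpectrum (𝓞 F)) (· ∈ X.S) (LGPFrobenioidName X.lstar)
      (fun A B => divisorObjects X A ≃ divisorObjects X B) (divisorObjects X) id LGPStripName
      (fun _ _ => Unit) (fun v (_ : v ∈ X.S) => Fin X.lstar → (v.adicCompletion F)ˣ) where
  FMOD := .MOD
  Fmod := .smallMod
  Ffrak := .frak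
  isoModMOD _ := Equiv.refl _
  isoModFrak _ := Equiv.refl _
  isoFrakMOD _ := Equiv.refl _
  CLGP := .CLGP
  Clgp := .Clgp
  FLGP := .LGP
  Flgp := .lgp
  Fgau := .gau
  isoGauLGP := ()
  isoLGPlgp := ()
  isoCLGPlgp := Equiv.refl _
  embLGP := id
  embLgp := id
  embLGP_injective := Function.injective_id
  embLgp_injective := Function.injective_id
  objOfLgp := obj
  objOfLGP := obj
  objOfFrak := obj
  objOfMOD := obj

/-- The divisor-level signature in the `q_v`-CONVENTION: object-forming map `thetaObjOf X` (coefficient `1/2l`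
carries the printed root `q̲_v = q_v^{1/2l}`; `ThetaPilotObjectsReal.lean`). [claim: Mochizuki2012, status: disputed] -/
def divisorSignatureDH := divisorSignature X (thetaObjOf X)

/-- The divisor-level signature in the printed ROOT CONVENTION: object-forming map `thetaObjOfRoot X`
(`ThetaPilotObjectsRoot.lean`). [claim: Mochizuki2012, status: disputed] -/
def divisorSignatureRoot := divisorSignature X (thetaObjOfRoot X)

variable (τ : ∀ v ∈ X.S, (v.adicCompletion F)ˣ)
  (hτ : ∀ v (hv : v ∈ X.S), ‖(τ v hv : v.adicCompletion F)‖ < 1 ∧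
    tateJ (τ v hv : v.adicCompletion F) = (X.jE : v.adicCompletion F))
  (ζ : ∀ v ∈ X.S, Fin X.lstar → ((v.adicCompletion F)ˣ)ˣ)
  (hζ : ∀ v (hv : v ∈ X.S) (i : Fin X.lstar), ζ v hv i ∈ rootsOfUnity (2 * X.l) ((v.adicCompletion F)ˣ))

include hτ hζ in
/-- **The Θ-pilot object of [IUTchIII] Def. 3.8 (i) IS the theta-pilot lgp-divisor `P_Θ`** at the Dupuy–Hilado
level, `q_v`-convention: for the divisor-level signature and the splitting monoids `μ_{2l}^{diag} · (ζ_j q_v^{j²})_j^ℕ`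
of a Tate family `τ`, `thetaPilotObject = X.thetaPilot` (abc-iut-c312-3's `PilotData.thetaPilot`) — no
hypothesis beyond the Tate family and the torsion of the profile. [claim: Mochizuki2012, status: disputed] -/
theorem thetaPilotObject_divisorSignatureDH :
    thetaPilotObject (divisorSignatureDH X) (SplittingMonoids.dh X τ ζ) = X.thetaPilot :=
  thetaPilotObject_eq_of_factors X τ hτ ζ hζ (divisorSignatureDH X) id (fun _ => rfl)

include hτ hζ in
/-- `thetaPilotObject_wellDefined` ("determined by ANY collection … of generators up to torsion", Def. 3.8 (i)
p. 112) HOLDS for the divisor-level signature, `q_v`-convention. [claim: Mochizuki2012, status: disputed] -/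
theorem thetaPilotObject_wellDefined_divisorSignatureDH :
    thetaPilotObject_wellDefined (divisorSignatureDH X) (SplittingMonoids.dh X τ ζ) :=
  thetaPilotObject_wellDefined_of_factors X τ hτ ζ hζ (divisorSignatureDH X) id (fun _ => rfl)

variable (ρ : ∀ v ∈ X.S, (v.adicCompletion F)ˣ) (hρ : ∀ v (hv : v ∈ X.S), ρ v hv ^ (2 * X.l) = τ v hv)

include hτ hρ hζ in
/-- **The Θ-pilot object IS `P_Θ`**, printed ROOT convention: for the divisor-level signature with
`thetaObjOfRoot` and the printed splitting monoids `μ_{2l}^{diag} · (ζ_j q̲_v^{j²})_j^ℕ` (`SplittingMonoids.dhRoot`),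
`thetaPilotObject = X.thetaPilot`. [claim: Mochizuki2012, status: disputed] -/
theorem thetaPilotObject_divisorSignatureRoot :
    thetaPilotObject (divisorSignatureRoot X) (SplittingMonoids.dhRoot X ρ ζ) = X.thetaPilot :=
  thetaPilotObject_eq_of_factors_root X τ hτ ρ hρ ζ hζ (divisorSignatureRoot X) id (fun _ => rfl)

include hτ hρ hζ in
/-- `thetaPilotObject_wellDefined` HOLDS for the divisor-level signature, ROOT convention.
[claim: Mochizuki2012, status: disputed] -/
theorem thetaPilotObject_wellDefined_divisorSignatureRoot :
    thetaPilotObject_wellDefined (divisorSignatureRoot X) (SplittingMonoids.dhRoot X ρ ζ) :=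
  thetaPilotObject_wellDefined_of_factors_root X τ hτ ρ hρ ζ hζ (divisorSignatureRoot X) id (fun _ => rfl)

/-- The realified product embedding of Prop. 3.7 (v) at the divisor level sends the Θ-pilot object to the
family of its `j`-components `(P_{Θ,j})_j` — the identity on lgp-divisors. [claim: Mochizuki2012, status: disputed] -/
theorem embLgp_divisorSignature
    (obj : (∀ v (_ : v ∈ X.S), Fin X.lstar → (v.adicCompletion F)ˣ) → LgpDivisor F X.lstar)
    (P : LgpDivisor F X.lstar) : (divisorSignature X obj).embLgp P = P :=
  rfl

end DivisorSignature

end Literature.IUT.LogThetaLattice
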